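import Summits.HodgeConjecture.HodgeConjecture.Theorems.PadicSemiregularLiftAbelianAnchorAssembly
import Literature.AlgebraicGeometry.HodgeTheory.AbelianLowDimensionHodgeConjecture

/-!
# `AbelianAnchorAssembly` (stmt-HodgeConjecture-14913) — the node is its part `dim A ≥ 6`

Route `PadicSemiregularLift`, support item (abelian anchor-class glue node)
`AbelianAnchorAssembly := HodgeLocusPropagation → FormalLiftingFromClassLifting →
FormalVectorBundlesAlgebraize → HodgeAbelianVarieties`.

`PadicSemiregularLiftAbelianAnchorAssembly.lean` (p89354) records that, granted the three engine items, the
node is LITERALLY the crux `HodgeAbelianVarieties` (HC for every complex abelian variety), and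
`HodgeAbelianVarieties/Negative/ExtremeCodimensions.lean` that the crux is its middle-codimension part and,
granting Lefschetz `(1,1)` + hard Lefschetz, its deep-middle part `2 ≤ p`, `2p ≤ dim A` ("a minimal
counterexample has `dim A ≥ 4` (in print `≥ 6`: Markman, arXiv:2509.23403 Cor. 1.3)").

This file makes the parenthesis formal. With the named fact
`Markman2025_hodgeClasses_algebraic_abelian_dim_le_five` (Markman 2025, Cor. 1.3: on a complex abelian
variety of dimension `≤ 5` every rational `(p,p)`-class is algebraic — Moonen–Zarhin + Ramón Marí + Tankeev
+ the algebraicity of Weil classes on fourfolds of Weil type; Literature file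
`AlgebraicGeometry/HodgeTheory/AbelianLowDimensionHodgeConjecture`) and the Hodge-model fact
`nonempty_hodgeModel`:

* `hodgeConjectureFor_abelian_of_dim_le_five`: the node's conclusion holds instancewise at every abelian
  variety of dimension `≤ 5` (extends `abelianAnchorAssembly_inst_of_dim_le_one`);
* `hodgeAbelianVarieties_iff_dim_ge_six`, `abelianAnchorAssembly_iff_dim_ge_six_of_engine`: the crux, and
  granted the engine the node, are EXACTLY the cycle part of HC for abelian varieties of dimension `≥ 6` in
  the middle codimensions `1 ≤ p < dim A`;
* `…_deepMiddle` variants: granting also Lefschetz `(1,1)` and hard Lefschetz (tree facts), exactly the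
  part `dim A ≥ 6`, `2 ≤ p`, `2p ≤ dim A` — whose first instance, `dim A = 6`, `p ∈ {2, 3}`, contains the
  Weil classes of sixfolds of Weil type of every discriminant
  (`weilClasses_sixfold_algebraic_of_abelianAnchorAssembly`; in print only discriminant `-1` is known,
  `Markman2025_weilClasses_algebraic_hyperbolicSixfold`), the route's own first open instance ("a rational
  Weil-plane generator on `E⁶ ⊗ 𝔽̄_p`", item docstring);
* `abelianAnchorAssembly_of_dim_ge_six`: conversely HC for abelian varieties of dimension `≥ 6` alone gives
  the node (engine idle).

All statements are CONDITIONAL on the named facts they list (taken as hypotheses, D-0014); nothing asserts a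
Theses declaration unconditionally.
-/

-- `Summit.HodgeConjecture.HodgeConjecture.…` is the tree's mandated summit/problem namespace (single-problem summit):
-- the duplicated component is by design (CONVENTIONS §1), so the dupNamespace linter is silenced for this file.
set_option linter.dupNamespace false

noncomputable section

namespace Summit.HodgeConjecture.HodgeConjecture.Theorems

open Summit.HodgeConjecture.HodgeConjecture.Theses.PadicSemiregularLift
open Literature.AlgebraicGeometry Literature.AlgebraicGeometry.HodgeTheory
  Literature.AlgebraicGeometry.Motives Literature.AlgebraicTopology.SingularHomology

/-! ### Dimension `≤ 5`: the node's conclusion holds instancewise -/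

/-- **The node's conclusion at every abelian variety of dimension `≤ 5`**, from Markman's Cor. 1.3 and the
Hodge-model fact (smooth-projectivity of `A.X` is PROVED, `AbelianVariety.isSmoothProjective_holds`).
[claim: Markman2025SurveySecant, status: under-review] -/
theorem hodgeConjectureFor_abelian_of_dim_le_five
    (h5 : Markman2025_hodgeClasses_algebraic_abelian_dim_le_five)
    (hM : ∀ (n : ℕ) (X : SchemeOver ℂ), nonempty_hodgeModel n X)
    (A : AbelianVariety ℂ) (hA : A.dim ≤ 5) : HodgeConjectureFor A.dim A.X :=
  hodgeConjectureFor_abelian_of_dim_le_five_of h5 A (hM _ _) hA AbelianVariety.isSmoothProjective_holds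

/-! ### The crux and the node are their part `dim A ≥ 6` -/

/-- **The crux `HodgeAbelianVarieties` is exactly the cycle part of HC for abelian varieties of dimension
`≥ 6` in the middle codimensions** `1 ≤ p < dim A`, granted `nonempty_hodgeModel` and Markman's Cor. 1.3
(`dim ≤ 5`): the extreme codimensions are free (`HodgeAbelianVarieties.Negative.hodgeAbelianVarieties_iff_middle`)
and `dim ≤ 5` is the fact. [claim: Markman2025SurveySecant, status: under-review] -/
theorem hodgeAbelianVarieties_iff_dim_ge_six
    (hM : ∀ (n : ℕ) (X : SchemeOver ℂ), nonempty_hodgeModel n X)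
    (h5 : Markman2025_hodgeClasses_algebraic_abelian_dim_le_five) :
    HodgeAbelianVarieties ↔
      ∀ A : AbelianVariety ℂ, 6 ≤ A.dim → ∀ p : ℕ, 1 ≤ p → p < A.dim →
        ∀ c : singularCohomology ℂ ℂ (ComplexPoints A.X) (2 * p), IsRationalClass c →
          IsOfHodgeType A.dim A.X (2 * p) p p c → c ∈ algebraicClasses A.X p := by
  refine ⟨fun h A _ p _ _ c hc hpp ↦ (h A).2 p c hc hpp, fun h ↦ ?_⟩
  refine HodgeAbelianVarieties.Negative.hodgeAbelianVarieties_iff_middle.2 fun A ↦ ⟨?_, ?_⟩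
  · exact hM _ _ (AbelianVariety.isSmoothProjective_holds (A := A))
  · intro p h1 hp c hc hpp
    by_cases h6 : 6 ≤ A.dim
    · exact h A h6 p h1 hp c hc hpp
    · exact h5 A (by omega) AbelianVariety.isSmoothProjective_holds p c hc hpp

/-- **Deep-middle form**: granting also Lefschetz `(1,1)` (`lefschetzOneOne_rational`) and hard Lefschetz
(`nonempty_hardLefschetzNFold`), the crux is exactly the cycle part of HC for abelian varieties of dimension
`≥ 6` in codimensions `2 ≤ p`, `2p ≤ dim A` (`HodgeAbelianVarieties.Negative.hodgeAbelianVarieties_iff_deepMiddle`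
+ the `dim ≤ 5` fact). First instance: `dim A = 6`, `p ∈ {2, 3}`.
[claim: Markman2025SurveySecant, status: under-review] -/
theorem hodgeAbelianVarieties_iff_dim_ge_six_deepMiddle
    (hM : ∀ (n : ℕ) (X : SchemeOver ℂ), nonempty_hodgeModel n X)
    (h11 : lefschetzOneOne_rational)
    (hHL : ∀ (n : ℕ) (X : SchemeOver ℂ), nonempty_hardLefschetzNFold n X)
    (h5 : Markman2025_hodgeClasses_algebraic_abelian_dim_le_five) :
    HodgeAbelianVarieties ↔
      ∀ (A : AbelianVariety ℂ) (p : ℕ), 6 ≤ A.dim → 2 ≤ p → 2 * p ≤ A.dim →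
        ∀ c : singularCohomology ℂ ℂ (ComplexPoints A.X) (2 * p), IsRationalClass c →
          IsOfHodgeType A.dim A.X (2 * p) p p c → c ∈ algebraicClasses A.X p := by
  rw [HodgeAbelianVarieties.Negative.hodgeAbelianVarieties_iff_deepMiddle hM h11 hHL]
  refine ⟨fun h A p _ h2 h2p c hc hpp ↦ h A p h2 h2p c hc hpp, fun h A p h2 h2p c hc hpp ↦ ?_⟩
  by_cases h6 : 6 ≤ A.dim
  · exact h A p h6 h2 h2p c hc hpp
  · exact h5 A (by omega) AbelianVariety.isSmoothProjective_holds p c hc hpp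

/-- **Granted the engine, the node `AbelianAnchorAssembly` is exactly the cycle part of HC for abelian
varieties of dimension `≥ 6` in the middle codimensions** (`abelianAnchorAssembly_iff_of_engine` +
`hodgeAbelianVarieties_iff_dim_ge_six`). [claim: Markman2025SurveySecant, status: under-review] -/
theorem abelianAnchorAssembly_iff_dim_ge_six_of_engine (hP : HodgeLocusPropagation)
    (h1a : FormalLiftingFromClassLifting) (h3a : FormalVectorBundlesAlgebraize)
    (hM : ∀ (n : ℕ) (X : SchemeOver ℂ), nonempty_hodgeModel n X)
    (h5 : Markman2025_hodgeClasses_algebraic_abelian_dim_le_five) :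
    AbelianAnchorAssembly ↔
      ∀ A : AbelianVariety ℂ, 6 ≤ A.dim → ∀ p : ℕ, 1 ≤ p → p < A.dim →
        ∀ c : singularCohomology ℂ ℂ (ComplexPoints A.X) (2 * p), IsRationalClass c →
          IsOfHodgeType A.dim A.X (2 * p) p p c → c ∈ algebraicClasses A.X p := by
  rw [abelianAnchorAssembly_iff_of_engine hP h1a h3a]
  exact hodgeAbelianVarieties_iff_dim_ge_six hM h5

/-- **Granted the engine, Lefschetz `(1,1)` and hard Lefschetz, the node is exactly the deep-middle cycle
part of HC for abelian varieties of dimension `≥ 6`** (`2 ≤ p`, `2p ≤ dim A`).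
[claim: Markman2025SurveySecant, status: under-review] -/
theorem abelianAnchorAssembly_iff_dim_ge_six_deepMiddle_of_engine (hP : HodgeLocusPropagation)
    (h1a : FormalLiftingFromClassLifting) (h3a : FormalVectorBundlesAlgebraize)
    (hM : ∀ (n : ℕ) (X : SchemeOver ℂ), nonempty_hodgeModel n X)
    (h11 : lefschetzOneOne_rational)
    (hHL : ∀ (n : ℕ) (X : SchemeOver ℂ), nonempty_hardLefschetzNFold n X)
    (h5 : Markman2025_hodgeClasses_algebraic_abelian_dim_le_five) :
    AbelianAnchorAssembly ↔
      ∀ (A : AbelianVariety ℂ) (p : ℕ), 6 ≤ A.dim → 2 ≤ p → 2 * p ≤ A.dim →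
        ∀ c : singularCohomology ℂ ℂ (ComplexPoints A.X) (2 * p), IsRationalClass c →
          IsOfHodgeType A.dim A.X (2 * p) p p c → c ∈ algebraicClasses A.X p := by
  rw [abelianAnchorAssembly_iff_of_engine hP h1a h3a]
  exact hodgeAbelianVarieties_iff_dim_ge_six_deepMiddle hM h11 hHL h5

/-- **Conversely, HC for abelian varieties of dimension `≥ 6` alone gives the node** (engine idle; `dim ≤ 5`
from the fact, anti-vacuity from `nonempty_hodgeModel`). [claim: Markman2025SurveySecant, status: under-review] -/
theorem abelianAnchorAssembly_of_dim_ge_six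
    (hM : ∀ (n : ℕ) (X : SchemeOver ℂ), nonempty_hodgeModel n X)
    (h5 : Markman2025_hodgeClasses_algebraic_abelian_dim_le_five)
    (h : ∀ A : AbelianVariety ℂ, 6 ≤ A.dim → HodgeConjectureFor A.dim A.X) : AbelianAnchorAssembly := by
  refine abelianAnchorAssembly_of_hodgeAbelianVarieties fun A ↦ ?_
  by_cases h6 : 6 ≤ A.dim
  · exact h A h6
  · exact hodgeConjectureFor_abelian_of_dim_le_five h5 hM A (by omega)

/-! ### The first instance beyond print: Weil classes on abelian sixfolds of every discriminant -/

/-- **The node (with its engine) contains the algebraicity of the Weil classes of EVERY abelian sixfold of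
Weil type** — every discriminant, not only the hyperbolic (discriminant `-1`) ones of
`Markman2025_weilClasses_algebraic_hyperbolicSixfold` (arXiv:2502.03415 Thm. 1.5.1): for `φ ≫ φ = -d`, every
rational `(3,3)`-class in the Weil plane `weilClassesOf A φ 3 d ⊆ H⁶(A(ℂ); ℂ)` of an abelian sixfold is
algebraic. This is the formal shape of the item's own first open instance ("a rational Weil-plane
generator on `E⁶ ⊗ 𝔽̄_p`, `p` inert in the Weil field, disc `≠ -1`"). The Weil-plane hypothesis is not even
used: the node gives all of `Hdg³`. [cite: Markman2025SecantWeil, Thm. 1.5.1] -/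
theorem weilClasses_sixfold_algebraic_of_abelianAnchorAssembly (h : AbelianAnchorAssembly)
    (hP : HodgeLocusPropagation) (h1a : FormalLiftingFromClassLifting)
    (h3a : FormalVectorBundlesAlgebraize) (d : ℕ) (A : AbelianVariety ℂ) (φ : A ⟶ A)
    (hA : A.dim = 2 * 3) (c : singularCohomology ℂ ℂ (ComplexPoints A.X) (2 * 3))
    (hc : IsRationalClass c) (h33 : IsOfHodgeType (2 * 3) A.X (2 * 3) 3 3 c)
    (_hw : c ∈ weilClassesOf A φ 3 d) : c ∈ algebraicClasses A.X 3 := by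
  have hHC := h hP h1a h3a A
  rw [hA] at hHC
  exact hHC.2 3 c hc h33

end Summit.HodgeConjecture.HodgeConjecture.Theorems

end
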